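import Literature.NumberTheory.Automorphic.Liu2021.AppendixC.Thm415Pinned
import Literature.NumberTheory.Automorphic.HeckeGelfandTrick
import HarnessLib

/-!
# [Liu 2021, §4.2 l. 2162–2165] the Hom-space `Hom_𝔾(ι_ℓ ∘ ω, ℚ̄_ℓ ⊗ H¹_ét(A_∞))` intertwines the Hecke OPERATORS

Topic `NumberTheory/Automorphic/Liu2021/AppendixC`; namespace `Literature.NumberTheory.Automorphic.Liu2021.AppendixC`.
Continuation of `Thm415Pinned.lean` §2 (`Sec42Data.EtaleHeckeDatum.omegaHom`): an element `f` of the Hom-space intertwines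
`ρW(g)` with `1 ⊗ rhoEt(g)` for EVERY `g ∈ 𝔾(𝔸_F^∞)` (its defining property), hence — being additive — it intertwines every
finite coset sum, i.e. every double-coset HECKE OPERATOR `[KgK]` (`Automorphic.heckeOperator`, Bump Prop. 4.2.3 / Cartier §IV.1)
on `K`-fixed vectors:

* `apply_heckeOperator_eq_sum` — `f ([KgK]_ω w) = ∑_{α ∈ K·gK} (1 ⊗ rhoEt(α.out)) (f w)` for `w ∈ ω^K`, `KgK/K` finite;
* `apply_heckeOperator_eq_baseChange_heckeOperator_apply` — the same read as `f ∘ [KgK]_ω = (1 ⊗ [KgK]_{rhoEt}) ∘ f` on `ω^K`;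
* `baseChange_rhoEt_apply_eq_self` — `f` carries `ω^K` into the `K`-invariants of `1 ⊗ rhoEt`.

This is the compatibility «`f′` intertwines the Hecke operators `T_w, S_w` at a hyperspecial place with the étale side» that
the congruence-relation statement of the cell `hodgecm-mathlib`'s d6 line (stub S3, [Liu2021, Cor. D.9]) is typed with (census
`A-provers/A-p06/CENSUS-D6-D2D3-hyperspecial-heckeTS` §0 (4)): NOTHING about the record's Hecke translates enters — they sit
inside `X.IsInducedBy`.  Kernel lemmas only (no `def`, no named fact, debt 0); count-neutral.  HC_CM is NOT proved here.

## References
* [Liu2021] Y. Liu, Camb. J. Math. 9 (2021) = arXiv:2102.11518, §4.2 (FJcycle.tex l. 2160–2166).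
* [Bump1997] D. Bump, *Automorphic Forms and Representations* (1997), Prop. 4.2.3.
* [CartierCorvallis1979] P. Cartier, Corvallis 1979, part 1, §IV.1.
-/

noncomputable section

open MulAction NumberField
open scoped TensorProduct

namespace Literature.NumberTheory.Automorphic.Liu2021.AppendixC

variable {F E : Type} [Field F] [NumberField F] [IsTotallyReal F] [Field E] [NumberField E] [Algebra F E]
  [IsTotallyComplex E] [Algebra.IsQuadraticExtension F E]
variable {P5 : PropC5Data F E} {isotropicAt : ℕ → Prop}

namespace Sec42Data.EtaleHeckeDatum

variable {C : Sec42Data P5 isotropicAt} {ℓ : ℕ} [Fact ℓ.Prime]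
variable (X : C.EtaleHeckeDatum ℓ) (ι : ℂ ≃+* AlgebraicClosure ℚ_[ℓ]) {W : Type} [AddCommGroup W] [Module ℂ W]
  (ρW : Representation ℂ C.G W)

/-- Base change of linear maps commutes with finite sums (Mathlib `LinearMap.baseChange_add`, `baseChange_zero`, by induction).
[folklore] -/
private theorem baseChange_finset_sum {R A M N : Type*} [CommRing R] [CommRing A] [Algebra R A] [AddCommGroup M] [Module R M]
    [AddCommGroup N] [Module R N] {ι' : Type*} (s : Finset ι') (T : ι' → M →ₗ[R] N) :
    (∑ i ∈ s, T i).baseChange A = ∑ i ∈ s, (T i).baseChange A := by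
  classical
  induction s using Finset.induction_on with
  | empty => rw [Finset.sum_empty, Finset.sum_empty, LinearMap.baseChange_zero]
  | insert a s ha ih => rw [Finset.sum_insert ha, Finset.sum_insert ha, LinearMap.baseChange_add, ih]

/-- **`f ([KgK] w) = ∑_{α ∈ K·gK} (1 ⊗ rhoEt(α.out)) (f w)`** for `f` in the Hom-space, `w ∈ ω^K` and `KgK/K` finite: `f` intertwines
every `ρW(y)` with `1 ⊗ rhoEt(y)` (`mem_omegaHom_iff`) and is additive; `[KgK] w = ∑_{α} ρW(α.out) w`
(`heckeOperator_apply_eq_sum_out`). [cite: Liu2021, §4.2 (FJcycle.tex l. 2162–2165)] [cite: Bump1997, Prop. 4.2.3] -/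
theorem apply_heckeOperator_eq_sum
    {f : W →ₛₗ[(ι : ℂ →+* AlgebraicClosure ℚ_[ℓ])] AlgebraicClosure ℚ_[ℓ] ⊗[ℚ_[ℓ]] C.etaleH1Tower ℓ}
    (hf : f ∈ X.omegaHom ι ρW) (K : Subgroup C.G) (g : C.G) (hfin : (orbit K (g : C.G ⧸ K)).Finite)
    {w : W} (hw : w ∈ ρW.fixedPoints K) :
    f (heckeOperator ρW K g w) =
      ∑ α ∈ hfin.toFinset, (X.rhoEt α.out).baseChange (AlgebraicClosure ℚ_[ℓ]) (f w) := by
  rw [heckeOperator_apply_eq_sum_out ρW K g hfin hw, map_sum]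
  exact Finset.sum_congr rfl fun α _ => hf _ _

/-- **`f ∘ [KgK]_ω = (1 ⊗ [KgK]_{rhoEt}) ∘ f` on `ω^K`**: the Hom-space intertwines the Hecke OPERATOR of the double coset `KgK`
on `(W, ρW)` with the base change of the same double-coset operator on the étale tower `(H¹_ét(A_∞), rhoEt)`.
[cite: Liu2021, §4.2 (FJcycle.tex l. 2162–2165)] [cite: CartierCorvallis1979, §IV.1] -/
theorem apply_heckeOperator_eq_baseChange_heckeOperator_apply
    {f : W →ₛₗ[(ι : ℂ →+* AlgebraicClosure ℚ_[ℓ])] AlgebraicClosure ℚ_[ℓ] ⊗[ℚ_[ℓ]] C.etaleH1Tower ℓ}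
    (hf : f ∈ X.omegaHom ι ρW) (K : Subgroup C.G) (g : C.G) (hfin : (orbit K (g : C.G ⧸ K)).Finite)
    {w : W} (hw : w ∈ ρW.fixedPoints K) :
    f (heckeOperator ρW K g w) =
      (heckeOperator X.rhoEt K g).baseChange (AlgebraicClosure ℚ_[ℓ]) (f w) := by
  rw [apply_heckeOperator_eq_sum X ι ρW hf K g hfin hw, heckeOperator, finsum_mem_eq_finite_toFinset_sum _ hfin,
    baseChange_finset_sum, LinearMap.sum_apply]

/-- **The Hom-space carries `ω^K` into the `K`-invariants of `1 ⊗ rhoEt`**: for `k ∈ K` and `w ∈ ω^K`,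
`(1 ⊗ rhoEt(k)) (f w) = f (ρW(k) w) = f w`. [cite: Liu2021, §4.2 (FJcycle.tex l. 2160–2166)] -/
theorem baseChange_rhoEt_apply_eq_self
    {f : W →ₛₗ[(ι : ℂ →+* AlgebraicClosure ℚ_[ℓ])] AlgebraicClosure ℚ_[ℓ] ⊗[ℚ_[ℓ]] C.etaleH1Tower ℓ}
    (hf : f ∈ X.omegaHom ι ρW) (K : Subgroup C.G) {k : C.G} (hk : k ∈ K) {w : W} (hw : w ∈ ρW.fixedPoints K) :
    (X.rhoEt k).baseChange (AlgebraicClosure ℚ_[ℓ]) (f w) = f w := by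
  rw [← hf k w, (ρW.mem_fixedPoints K w).1 hw k hk]

end Sec42Data.EtaleHeckeDatum

end Literature.NumberTheory.Automorphic.Liu2021.AppendixC

end
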